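import Summits.ResolutionOfSingularities.ResolutionOfSingularities.Theorems.WeightedInvariantKeyRungThreeOfDescentFiniteResidue
import Summits.ResolutionOfSingularities.ResolutionOfSingularities.Theorems.WeightedInvariantIotaFlatTTorusFactorDoor
import HarnessLib

/-!
# The gap list of `stub_keyRungGrHomLE_three` with the σ generic-fibre input DOOR-TYPED AND AT FINITE RESIDUE FIELDS ONLY
# (door `HypersurfaceCentreConstruction`, stmt-ResolutionOfSingularities-19897; registered stub `stub_keyRungGrHomLE_three`; audit glue)

Topic: `Summits/ResolutionOfSingularities/ResolutionOfSingularities/Theorems`. Helper for the door item `HypersurfaceCentreConstruction`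
(stmt-ResolutionOfSingularities-19897, route `WeightedInvariant`), line `local-engine` (skeleton v3.12 `7a4b52ef`), def-free.  Sequel of
`keyRungGrHomLE_three_of_descent''` (…KeyRungThreeOfDescentFiniteResidue, p818362): the σ-input of hc10 is consumed by the door-typed clause
(c10)≤3 at rings essentially of finite type over the perfect ground field only (`Iota3.iotaFlatT_torusFactorMonotoneLE_of_tauEssSmooth_door`,
…IotaFlatTTorusFactorDoor), so in the gap list `hσ` becomes

  `hσdoorfin`: for every perfect field `k₀` of characteristic `p`, every regular local `T` essentially of finite type over `k₀` with FINITE residue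
  field and `dim T ≤ 3`, and every `g ∈ T`: `σ(T(X), C g) ≤ σ(T, g)` at the generic fibre point `T(X) = T[X]_{𝔪T[X]}`

(an `𝔽_p`-algebra statement about closed points of threefolds over finite fields; mixed characteristic and non-excellent rings are gone from this input).

* **`keyRungGrHomLE_three_of_descent_door`** — THE GAP LIST AFTER THIS FILE: (desc-τ) [door-proved: `Iota3.isTiePosition_descent_door`, p817623;
  as typed a typing item], `hσdoorfin`, (σ-pt), GAP 2, hgame, the residue of the dominance word at the power positions.

[OURS · L1 W4.3 · audit glue]  Replaces the role of NO printed item; NOT a statement of the manuscript under review [claim: Hironaka2017, status: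
under-review]; candidates stay candidates; AI work, weaker than expert review.  No definition; no axiom; every input is a hypothesis.

## References

* H. Hironaka, *Characteristic polyhedra of singularities*, J. Math. Kyoto Univ. 7 (1967), §3. [Hironaka1967]
* H. Matsumura, *Commutative Ring Theory* (1987), §8. [Matsumura1987]
-/

noncomputable section

set_option linter.dupNamespace false -- mandated namespace `Summit.<Summit>.<Problem>` of this single-conjunct summit

open IsLocalRing Literature.AlgebraicGeometry.Resolution Polynomial
open Summit.ResolutionOfSingularities.ResolutionOfSingularities.Theorems
open Summit.ResolutionOfSingularities.ResolutionOfSingularities.Theorems.ContactCylinder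

namespace Summit.ResolutionOfSingularities.ResolutionOfSingularities.Cruxes.HypersurfaceCentreConstruction.LocalEngine

open Iota3 in
/-- **P3 RUNG FOR THE NAMED PAIR MODULO THE GAP LIST AFTER THIS FILE** (`keyRungGrHomLE_three_of_descent''` with `hσfin` narrowed to the door
setting via `Iota3.iotaFlatT_torusFactorMonotoneLE_of_tauEssSmooth_door`): (desc-τ), `hσdoorfin`, (σ-pt), GAP 2, hgame, the residue of the dominance
word at the power positions. [OURS · audit glue] -/
theorem keyRungGrHomLE_three_of_descent_door (p : ℕ)
    (hD : ∀ (T T' : Type) [CommRing T] [IsRegularLocalRing T] [CommRing T'] [IsRegularLocalRing T'] [Algebra T T']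
      [IsLocalHom (algebraMap T T')] [Algebra.FormallySmooth T T'] [Algebra.EssFiniteType T T'] (g : T),
      ringKrullDim T' ≤ 3 → IsTiePosition T' (algebraMap T T' g) → IsTiePosition T g)
    (hσdoorfin : ∀ (k₀ : Type) [Field k₀] [CharP k₀ p] [PerfectField k₀]
      (T : Type) [CommRing T] [Algebra k₀ T] [Algebra.EssFiniteType k₀ T] [IsRegularLocalRing T] (g : T)
      [((maximalIdeal T).map (C : T →+* T[X])).IsPrime], Finite (ResidueField T) → ringKrullDim T ≤ 3 →
      iotaSigma (Localization.AtPrime ((maximalIdeal T).map (C : T →+* T[X])))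
        (algebraMap T[X] (Localization.AtPrime ((maximalIdeal T).map (C : T →+* T[X]))) (C g)) ≤ iotaSigma T g)
    (hσpt : ∀ (T T' : Type) [CommRing T] [IsRegularLocalRing T] [CommRing T'] [IsRegularLocalRing T'] [Algebra T T']
      [IsLocalHom (algebraMap T T')] [Algebra.FormallySmooth T T'] [Algebra.EssFiniteType T T'] (g : T) (𝔮' : Ideal T')
      [𝔮'.IsPrime], ringKrullDim T' ≤ 3 →
      iotaSigma (Localization.AtPrime 𝔮') (algebraMap T (Localization.AtPrime 𝔮') g) =
        iotaSigma (Localization.AtPrime (𝔮'.comap (algebraMap T T')))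
          (algebraMap T (Localization.AtPrime (𝔮'.comap (algebraMap T T'))) g))
    (hgap2 : ∀ (T T' : Type) [CommRing T] [IsRegularLocalRing T] [CommRing T'] [IsRegularLocalRing T'] [Algebra T T']
      [IsLocalHom (algebraMap T T')] [Algebra.FormallySmooth T T'] [Algebra.EssFiniteType T T'] (g : T),
      ringKrullDim T' ≤ 3 → (maximalIdeal T).map (algebraMap T T') = maximalIdeal T' → ringKrullDim T = (3 : ℕ) →
      iotaEps T g = 0 → ∀ m : ℕ, jSigmaPt T' (algebraMap T T' g) m = (jSigmaPt T g m).map (algebraMap T T'))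
    (hgame : CanonicalGameClauseHomLE 3 p iotaFlatT jFlatT)
    (hres : ∀ (k₀ : Type) [Field k₀] [CharP k₀ p] [PerfectField k₀]
      (S : Type) [CommRing S] [Algebra k₀ S] [Algebra.EssFiniteType k₀ S] [IsRegularLocalRing S] (f : S),
      ringKrullDim S = (3 : ℕ) → f ≠ 0 → f ∈ (maximalIdeal S) ^ 2 →
      ContactCylinder.topStratumPrime iotaOrdEpsTau S f = maximalIdeal S → iotaEps S f ≠ 1 →
      (∃ ℓ ∈ maximalIdeal S, f ∈ Ideal.span {ℓ ^ (adicOrder f).toNat} ⊔ maximalIdeal S ^ ((adicOrder f).toNat + 1)) →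
      ∀ (a b : ℕ), 0 < b →
      (∀ q' r₁' r₂' : ℕ, AdmissibleTriple q' r₁' r₂' → FlagReaches f (adicOrder f).toNat q' r₁' r₂' → r₁' * b ≤ a * r₂') →
      ∀ (g₁ g₂ g₁' g₂' : S) (q r₁ r₂ : ℕ), AdmissibleTriple q r₁ r₂ → r₁ * b = a * r₂ → q < r₂ → r₂ < r₁ →
        IsTwoFlag g₁ g₂ → IsTwoFlag g₁' g₂' →
        f ∈ flagContactFiltration g₁ g₂ q r₁ r₂ (r₁ * (adicOrder f).toNat) →
        f ∈ flagContactFiltration g₁' g₂' q r₁ r₂ (r₁ * (adicOrder f).toNat) →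
        g₂' ∈ flagContactFiltration g₁ g₂ q r₁ r₂ r₂) :
    KeyRungGrHomLE 3 p :=
  keyRungGrHomLE_three_of_residue_at_powers' p
    (iotaFlatT_torusFactorMonotoneLE_of_tauEssSmooth_door p
      (fun T T' _ _ _ _ _ _ _ _ g hd => iotaTau_essSmooth_eq_of_descent hD T T' g hd) hσdoorfin)
    (iotaJEssSmoothCompatibleLE_three_of_sigmaPt hD hσpt hgap2) hgame hres (iotaFlatT_upperSemicontinuousGradedLE_three p)

end Summit.ResolutionOfSingularities.ResolutionOfSingularities.Cruxes.HypersurfaceCentreConstruction.LocalEngine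

end
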